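import Summits.SmoothPoincare4.SmoothPoincare4.Theorems.CylinderEntropyCylinderRungTwoFluxIdentityPushOff
import HarnessLib

/-!
# End-separation persists along a cylinder flow, part 1: the augmented tube chart and its partial derivatives

Part of the proof of the stub `stub_separationPersists` (END-SEPARATION PERSISTS ALONG A CYLINDER
FLOW) of line `conformal-kernel-domination` (closing chain γ) of the crux `CylinderEntropy.SliceIsolation`
(stmt-SmoothPoincare4-7632); see `CylinderEntropySliceIsolationStubSeparationPersists.lean` for the
overall argument. Everything here is proved (no named facts, no definitions: the tube chart is passed
as a function `Ψ` with the hypothesis `hΨ` spelling it out, instantiated by `rfl`).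

For a smooth embedding `ι : M → N = S⁴ × ℝ ⊂ ℝ⁶` of a `4`-manifold with a smooth unit normal `ν`
tangent to `N`, and a point `x₀ ∈ M` with extended chart `φ`, the **augmented tube chart**
`Ψ(b, r, ρ) = (1 + ρ) ⊙ nrm(ι(φ⁻¹ b) + r ν(φ⁻¹ b))` (push off along `ν`, normalise radially back
onto `N` — `nrm z = z'/‖z'‖ + z₅ e₅`, the inline normalisation of the flux-identity files — then
scale the horizontal part by `1 + ρ`) is `C^∞` near `(φ x₀, 0, 0)` (`contDiffAt_tubeChart`), with
partial derivatives `D(ι ∘ φ⁻¹)` in `b` (`fderiv_tubeChart_inl`), `ν(x₀)` in `r`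
(`fderiv_tubeChart_r`, the push-off curve moves off `N` only to second order,
`hasDerivAt_nrm_pushoff`) and the radial unit normal `n(x₀)` in `ρ` (`fderiv_tubeChart_rho`).

## References

* M. W. Hirsch, *Differential Topology*, GTM 33 (1976), Ch. 4 §5 (tubular neighbourhoods), Ch. 8
  Thm. 1.3 (isotopy extension). [HirschDT1976]
* A. Hatcher, *Algebraic Topology*, CUP (2002), Prop. 3.46 (Jordan–Brouwer separation via Alexander
  duality). [HatcherAT2002]
-/

set_option linter.dupNamespace false

noncomputable section

open MeasureTheory Set Function Filter Module Asymptotics Metric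
open scoped Manifold ContDiff ENNReal Topology RealInnerProductSpace NNReal

namespace Summit.SmoothPoincare4.SmoothPoincare4.Theorems.CylinderEntropySliceIsolation

open Summit.SmoothPoincare4.SmoothPoincare4.Theorems.CylinderRungTwo.KillingFlux
open Literature.Geometry.Riemannian
open Literature.Geometry.Lorentzian Literature.Geometry.Lorentzian.PseudoRiemannianMetric
open Literature.Geometry.Riemannian.SphericalCylinderEntropy (truncL truncL_apply lipschitz_truncL)
open Literature.Geometry.Manifold.CylinderSlice (axis castSucc_ne_five padL padL_apply_castSucc
  padL_apply_last)

/-! ## §1 The radial normalisation is smooth off the axis -/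

section Nrm

/-- The radial normalisation `nrm z = z'/‖z'‖ + z₅ e₅` is `C^n` at every point off `{z' = 0}`.
[folklore] -/
theorem contDiffAt_nrm {z : EuclideanSpace ℝ (Fin 6)} (hz : truncL z ≠ 0) {n : WithTop ℕ∞} :
    ContDiffAt ℝ n (fun z : EuclideanSpace ℝ (Fin 6) => (‖truncL z‖⁻¹ : ℝ) • (z - z (5 : Fin 6) •
      (axis : EuclideanSpace ℝ (Fin 6))) + z (5 : Fin 6) • (axis : EuclideanSpace ℝ (Fin 6))) z := by
  have h5 : ContDiff ℝ n fun z : EuclideanSpace ℝ (Fin 6) => z (5 : Fin 6) :=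
    (EuclideanSpace.proj (5 : Fin 6) : EuclideanSpace ℝ (Fin 6) →L[ℝ] ℝ).contDiff
  have hnorm : ContDiffAt ℝ n (fun z : EuclideanSpace ℝ (Fin 6) => ‖truncL z‖) z :=
    (truncL.contDiff.contDiffAt).norm (𝕜 := ℝ) hz
  have hinv : ContDiffAt ℝ n (fun z : EuclideanSpace ℝ (Fin 6) => (‖truncL z‖)⁻¹) z :=
    hnorm.inv (norm_ne_zero_iff.2 hz)
  exact (hinv.smul (contDiffAt_id.sub ((h5.smul contDiff_const).contDiffAt))).add
    (h5.smul contDiff_const).contDiffAt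

/-- **The push-off curve is tangent to its direction**: at a point `u ∈ N` and for a direction
`τ` tangent to `N`, `r ↦ nrm(u + r τ)` has derivative `τ` at `r = 0` (the normalisation moves
`u + rτ` by `O(r²)`, `norm_nrm_sub_le`). [folklore] -/
theorem hasDerivAt_nrm_pushoff {u τ : EuclideanSpace ℝ (Fin 6)}
    (hu : ∑ i : Fin 5, u (Fin.castSucc i) ^ 2 = 1)
    (hτ : ∑ i : Fin 5, τ (Fin.castSucc i) * u (Fin.castSucc i) = 0) :
    HasDerivAt (fun r : ℝ => (fun z : EuclideanSpace ℝ (Fin 6) => (‖truncL z‖⁻¹ : ℝ) • (z - z (5 : Fin 6) •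
      (axis : EuclideanSpace ℝ (Fin 6))) + z (5 : Fin 6) • (axis : EuclideanSpace ℝ (Fin 6))) (u + r • τ)) τ 0 := by
  rw [hasDerivAt_iff_isLittleO_nhds_zero]
  have h0 := nrm_eq_self hu
  have hbig : (fun h : ℝ => (fun z : EuclideanSpace ℝ (Fin 6) => (‖truncL z‖⁻¹ : ℝ) • (z - z (5 : Fin 6) •
      (axis : EuclideanSpace ℝ (Fin 6))) + z (5 : Fin 6) • (axis : EuclideanSpace ℝ (Fin 6))) (u + (0 + h) • τ) -
      (fun z : EuclideanSpace ℝ (Fin 6) => (‖truncL z‖⁻¹ : ℝ) • (z - z (5 : Fin 6) •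
      (axis : EuclideanSpace ℝ (Fin 6))) + z (5 : Fin 6) • (axis : EuclideanSpace ℝ (Fin 6))) (u + (0 : ℝ) • τ) -
      h • τ) =O[𝓝 0] fun h : ℝ => h ^ 2 := by
    refine IsBigO.of_bound (‖τ‖ ^ 2) (Eventually.of_forall fun h => ?_)
    have h2 := (norm_nrm_sub_le hu hτ h).2
    beta_reduce at h0 h2 ⊢
    rw [zero_smul, add_zero, h0, zero_add, Real.norm_eq_abs, abs_pow, sq_abs]
    calc _ = ‖(‖truncL (u + h • τ)‖⁻¹ • (u + h • τ - (u + h • τ) 5 • (axis : EuclideanSpace ℝ (Fin 6))) +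
          (u + h • τ) 5 • (axis : EuclideanSpace ℝ (Fin 6))) - (u + h • τ)‖ := by
          congr 1; abel
      _ ≤ h ^ 2 * ‖τ‖ ^ 2 := h2
      _ = ‖τ‖ ^ 2 * h ^ 2 := by ring
  exact hbig.trans_isLittleO (isLittleO_pow_id one_lt_two)

/-- Scaling the horizontal part of a point of `N` by `1 + ρ`, `|ρ| < 1`, stays in `N` only for
`ρ = 0`. [folklore] -/
theorem radScale_mem_iff {w : EuclideanSpace ℝ (Fin 6)} (hw : ∑ i : Fin 5, w (Fin.castSucc i) ^ 2 = 1)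
    {ρ : ℝ} (hρ : |ρ| < 1) :
    ∑ i : Fin 5, (w + ρ • (w - w (5 : Fin 6) • (axis : EuclideanSpace ℝ (Fin 6)))) (Fin.castSucc i) ^ 2 = 1 ↔
      ρ = 0 := by
  have hcoord : ∀ i : Fin 5, (w + ρ • (w - w (5 : Fin 6) • (axis : EuclideanSpace ℝ (Fin 6))))
      (Fin.castSucc i) = (1 + ρ) * w (Fin.castSucc i) := by
    intro i
    simp [axis, castSucc_ne_five i]
    ring
  simp only [hcoord, mul_pow, ← Finset.mul_sum, hw, mul_one]
  constructor
  · intro h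
    have h' : ρ * (ρ + 2) = 0 := by nlinarith
    rcases mul_eq_zero.1 h' with h'' | h''
    · exact h''
    · rw [abs_lt] at hρ; linarith [hρ.1]
  · rintro rfl; norm_num

end Nrm

/-! ## §2 The augmented tube chart and its differential

The **augmented tube chart** of the cross-section `ι` with normal `ν` at `x₀` is
`Ψ(b, r, ρ) = w + ρ (w - w₅ e₅)` with `w = nrm(ι(φ⁻¹ b) + r ν(φ⁻¹ b))`, `φ` the extended chart at `x₀`:
push off along the normal, normalise back onto `N`, scale the horizontal part by `1 + ρ`.  No
definition is introduced: every statement takes a function `Ψ` together with the hypothesis `hΨ`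
that `Ψ` is this explicit map (users instantiate `hΨ := rfl`). -/

section TubeChart

variable {M : Type} [TopologicalSpace M] [ChartedSpace (EuclideanSpace ℝ (Fin 4)) M]
  [IsManifold (𝓡 4) ∞ M]

omit [IsManifold (𝓡 4) ∞ M] in
/-- On the slice `ρ = 0` the tube chart is the normalised push-off `nrm(ι x + r ν x)`,
`x = φ⁻¹ b`. [folklore] -/
theorem tubeChart_zero (ι ν : M → EuclideanSpace ℝ (Fin 6)) {Ψ : EuclideanSpace ℝ (Fin 4) × ℝ × ℝ → EuclideanSpace ℝ (Fin 6)}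
    (x₀ : M) (hΨ : Ψ = fun p : EuclideanSpace ℝ (Fin 4) × ℝ × ℝ =>
      (fun z : EuclideanSpace ℝ (Fin 6) => (‖truncL z‖⁻¹ : ℝ) • (z - z (5 : Fin 6) •
        (axis : EuclideanSpace ℝ (Fin 6))) + z (5 : Fin 6) • (axis : EuclideanSpace ℝ (Fin 6)))
        (ι ((extChartAt (𝓡 4) x₀).symm p.1) + p.2.1 • ν ((extChartAt (𝓡 4) x₀).symm p.1)) +
      p.2.2 • ((fun z : EuclideanSpace ℝ (Fin 6) => (‖truncL z‖⁻¹ : ℝ) • (z - z (5 : Fin 6) •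
        (axis : EuclideanSpace ℝ (Fin 6))) + z (5 : Fin 6) • (axis : EuclideanSpace ℝ (Fin 6)))
        (ι ((extChartAt (𝓡 4) x₀).symm p.1) + p.2.1 • ν ((extChartAt (𝓡 4) x₀).symm p.1)) -
        ((fun z : EuclideanSpace ℝ (Fin 6) => (‖truncL z‖⁻¹ : ℝ) • (z - z (5 : Fin 6) •
        (axis : EuclideanSpace ℝ (Fin 6))) + z (5 : Fin 6) • (axis : EuclideanSpace ℝ (Fin 6)))
        (ι ((extChartAt (𝓡 4) x₀).symm p.1) + p.2.1 • ν ((extChartAt (𝓡 4) x₀).symm p.1))) (5 : Fin 6) •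
          (axis : EuclideanSpace ℝ (Fin 6)))) (b : EuclideanSpace ℝ (Fin 4)) (r : ℝ) :
    Ψ (b, r, 0) =
      (fun z : EuclideanSpace ℝ (Fin 6) => (‖truncL z‖⁻¹ : ℝ) • (z - z (5 : Fin 6) •
        (axis : EuclideanSpace ℝ (Fin 6))) + z (5 : Fin 6) • (axis : EuclideanSpace ℝ (Fin 6)))
        (ι ((extChartAt (𝓡 4) x₀).symm b) + r • ν ((extChartAt (𝓡 4) x₀).symm b)) := by
  subst hΨ
  simp

/-- The chart representative of a smooth map `g : M → ℝ⁶` is `C^∞` on the chart target. [folklore] -/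
theorem contDiffOn_chartRep_of_contMDiff {g : M → EuclideanSpace ℝ (Fin 6)} (hg : ContMDiff (𝓡 4) (𝓡 6) ∞ g)
    (x₀ : M) : ContDiffOn ℝ ∞ (g ∘ (extChartAt (𝓡 4) x₀).symm) (extChartAt (𝓡 4) x₀).target :=
  (hg.comp_contMDiffOn (contMDiffOn_extChartAt_symm (n := ∞) x₀)).contDiffOn

variable {ι ν : M → EuclideanSpace ℝ (Fin 6)} {Ψ : EuclideanSpace ℝ (Fin 4) × ℝ × ℝ → EuclideanSpace ℝ (Fin 6)}

/-- The tube chart is `C^∞` at every `(b, r, ρ)` with `b` in the chart target and `|ρ|`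
arbitrary (the pushed-off point `ι x + r ν x` is never on the axis: `‖(ι x + r ν x)'‖² = 1 + r²‖ν'‖²`).
[folklore] -/
theorem contDiffAt_tubeChart (hι : Manifold.IsSmoothEmbedding (𝓡 4) (𝓡 6) ∞ ι)
    (hιN : ∀ x, ∑ i : Fin 5, ι x (Fin.castSucc i) ^ 2 = 1) (hνs : ContMDiff (𝓡 4) (𝓡 6) ∞ ν)
    (hνt : ∀ x, ∑ i : Fin 5, ν x (Fin.castSucc i) * ι x (Fin.castSucc i) = 0) (x₀ : M)
    (hΨ : Ψ = fun p : EuclideanSpace ℝ (Fin 4) × ℝ × ℝ =>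
      (fun z : EuclideanSpace ℝ (Fin 6) => (‖truncL z‖⁻¹ : ℝ) • (z - z (5 : Fin 6) •
        (axis : EuclideanSpace ℝ (Fin 6))) + z (5 : Fin 6) • (axis : EuclideanSpace ℝ (Fin 6)))
        (ι ((extChartAt (𝓡 4) x₀).symm p.1) + p.2.1 • ν ((extChartAt (𝓡 4) x₀).symm p.1)) +
      p.2.2 • ((fun z : EuclideanSpace ℝ (Fin 6) => (‖truncL z‖⁻¹ : ℝ) • (z - z (5 : Fin 6) •
        (axis : EuclideanSpace ℝ (Fin 6))) + z (5 : Fin 6) • (axis : EuclideanSpace ℝ (Fin 6)))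
        (ι ((extChartAt (𝓡 4) x₀).symm p.1) + p.2.1 • ν ((extChartAt (𝓡 4) x₀).symm p.1)) -
        ((fun z : EuclideanSpace ℝ (Fin 6) => (‖truncL z‖⁻¹ : ℝ) • (z - z (5 : Fin 6) •
        (axis : EuclideanSpace ℝ (Fin 6))) + z (5 : Fin 6) • (axis : EuclideanSpace ℝ (Fin 6)))
        (ι ((extChartAt (𝓡 4) x₀).symm p.1) + p.2.1 • ν ((extChartAt (𝓡 4) x₀).symm p.1))) (5 : Fin 6) •
          (axis : EuclideanSpace ℝ (Fin 6))))
    {p : EuclideanSpace ℝ (Fin 4) × ℝ × ℝ} (hp : p.1 ∈ (extChartAt (𝓡 4) x₀).target) :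
    ContDiffAt ℝ ∞ Ψ p := by
  subst hΨ
  have hG : ContDiffAt ℝ ∞ (ι ∘ (extChartAt (𝓡 4) x₀).symm) p.1 :=
    (contDiffOn_chartRep_of_contMDiff hι.contMDiff x₀).contDiffAt ((isOpen_extChartAt_target x₀).mem_nhds hp)
  have hV : ContDiffAt ℝ ∞ (ν ∘ (extChartAt (𝓡 4) x₀).symm) p.1 :=
    (contDiffOn_chartRep_of_contMDiff hνs x₀).contDiffAt ((isOpen_extChartAt_target x₀).mem_nhds hp)
  have hinner : ContDiffAt ℝ ∞ (fun q : EuclideanSpace ℝ (Fin 4) × ℝ × ℝ =>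
      ι ((extChartAt (𝓡 4) x₀).symm q.1) + q.2.1 • ν ((extChartAt (𝓡 4) x₀).symm q.1)) p := by
    have h1 : ContDiffAt ℝ ∞ (fun q : EuclideanSpace ℝ (Fin 4) × ℝ × ℝ => (ι ∘ (extChartAt (𝓡 4) x₀).symm) q.1) p :=
      hG.comp p contDiffAt_fst
    have h2 : ContDiffAt ℝ ∞ (fun q : EuclideanSpace ℝ (Fin 4) × ℝ × ℝ => (ν ∘ (extChartAt (𝓡 4) x₀).symm) q.1) p :=
      hV.comp p contDiffAt_fst
    have h3 : ContDiffAt ℝ ∞ (fun q : EuclideanSpace ℝ (Fin 4) × ℝ × ℝ => q.2.1) p :=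
      contDiffAt_fst.comp p contDiffAt_snd
    exact h1.add (h3.smul h2)
  have htr : truncL (ι (PartialEquiv.symm (extChartAt (𝓡 4) x₀) p.1) + p.2.1 • ν (PartialEquiv.symm (extChartAt (𝓡 4) x₀) p.1)) ≠ 0 :=
    (norm_nrm_sub_le (hιN _) (hνt _) p.2.1).1
  have hnrm := (contDiffAt_nrm htr (n := ∞)).comp p hinner
  have h5 : ContDiff ℝ ∞ fun z : EuclideanSpace ℝ (Fin 6) => z (5 : Fin 6) :=
    (EuclideanSpace.proj (5 : Fin 6) : EuclideanSpace ℝ (Fin 6) →L[ℝ] ℝ).contDiff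
  have hw5 := h5.contDiffAt.comp p hnrm
  have hρ : ContDiffAt ℝ ∞ (fun q : EuclideanSpace ℝ (Fin 4) × ℝ × ℝ => q.2.2) p :=
    contDiffAt_snd.comp p contDiffAt_snd
  exact hnrm.add (hρ.smul (hnrm.sub (hw5.smul contDiffAt_const)))

omit [IsManifold (𝓡 4) ∞ M] in
/-- On the line `r = 0` over a point of the chart target the tube chart is the radial scaling
`ι x + ρ (ι x - (ι x)₅ e₅)` of `ι x ∈ N`, `x = φ⁻¹ b`. [folklore] -/
theorem tubeChart_zero_left (hιN : ∀ x, ∑ i : Fin 5, ι x (Fin.castSucc i) ^ 2 = 1) (x₀ : M)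
    (hΨ : Ψ = fun p : EuclideanSpace ℝ (Fin 4) × ℝ × ℝ =>
      (fun z : EuclideanSpace ℝ (Fin 6) => (‖truncL z‖⁻¹ : ℝ) • (z - z (5 : Fin 6) •
        (axis : EuclideanSpace ℝ (Fin 6))) + z (5 : Fin 6) • (axis : EuclideanSpace ℝ (Fin 6)))
        (ι ((extChartAt (𝓡 4) x₀).symm p.1) + p.2.1 • ν ((extChartAt (𝓡 4) x₀).symm p.1)) +
      p.2.2 • ((fun z : EuclideanSpace ℝ (Fin 6) => (‖truncL z‖⁻¹ : ℝ) • (z - z (5 : Fin 6) •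
        (axis : EuclideanSpace ℝ (Fin 6))) + z (5 : Fin 6) • (axis : EuclideanSpace ℝ (Fin 6)))
        (ι ((extChartAt (𝓡 4) x₀).symm p.1) + p.2.1 • ν ((extChartAt (𝓡 4) x₀).symm p.1)) -
        ((fun z : EuclideanSpace ℝ (Fin 6) => (‖truncL z‖⁻¹ : ℝ) • (z - z (5 : Fin 6) •
        (axis : EuclideanSpace ℝ (Fin 6))) + z (5 : Fin 6) • (axis : EuclideanSpace ℝ (Fin 6)))
        (ι ((extChartAt (𝓡 4) x₀).symm p.1) + p.2.1 • ν ((extChartAt (𝓡 4) x₀).symm p.1))) (5 : Fin 6) •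
          (axis : EuclideanSpace ℝ (Fin 6))))
    (b : EuclideanSpace ℝ (Fin 4)) (ρ : ℝ) :
    Ψ (b, 0, ρ) = ι ((extChartAt (𝓡 4) x₀).symm b) +
      ρ • (ι ((extChartAt (𝓡 4) x₀).symm b) - ι ((extChartAt (𝓡 4) x₀).symm b) (5 : Fin 6) •
        (axis : EuclideanSpace ℝ (Fin 6))) := by
  subst hΨ
  have h0 := nrm_eq_self (hιN ((extChartAt (𝓡 4) x₀).symm b))
  beta_reduce at h0
  simp only [zero_smul, add_zero, h0]

/-- The tube chart has a strict derivative at the centre `(φ x₀, 0, 0)` (it is `C^∞` there).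
[folklore] -/
theorem hasStrictFDerivAt_tubeChart (hι : Manifold.IsSmoothEmbedding (𝓡 4) (𝓡 6) ∞ ι)
    (hιN : ∀ x, ∑ i : Fin 5, ι x (Fin.castSucc i) ^ 2 = 1) (hνs : ContMDiff (𝓡 4) (𝓡 6) ∞ ν)
    (hνt : ∀ x, ∑ i : Fin 5, ν x (Fin.castSucc i) * ι x (Fin.castSucc i) = 0) (x₀ : M)
    (hΨ : Ψ = fun p : EuclideanSpace ℝ (Fin 4) × ℝ × ℝ =>
      (fun z : EuclideanSpace ℝ (Fin 6) => (‖truncL z‖⁻¹ : ℝ) • (z - z (5 : Fin 6) •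
        (axis : EuclideanSpace ℝ (Fin 6))) + z (5 : Fin 6) • (axis : EuclideanSpace ℝ (Fin 6)))
        (ι ((extChartAt (𝓡 4) x₀).symm p.1) + p.2.1 • ν ((extChartAt (𝓡 4) x₀).symm p.1)) +
      p.2.2 • ((fun z : EuclideanSpace ℝ (Fin 6) => (‖truncL z‖⁻¹ : ℝ) • (z - z (5 : Fin 6) •
        (axis : EuclideanSpace ℝ (Fin 6))) + z (5 : Fin 6) • (axis : EuclideanSpace ℝ (Fin 6)))
        (ι ((extChartAt (𝓡 4) x₀).symm p.1) + p.2.1 • ν ((extChartAt (𝓡 4) x₀).symm p.1)) -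
        ((fun z : EuclideanSpace ℝ (Fin 6) => (‖truncL z‖⁻¹ : ℝ) • (z - z (5 : Fin 6) •
        (axis : EuclideanSpace ℝ (Fin 6))) + z (5 : Fin 6) • (axis : EuclideanSpace ℝ (Fin 6)))
        (ι ((extChartAt (𝓡 4) x₀).symm p.1) + p.2.1 • ν ((extChartAt (𝓡 4) x₀).symm p.1))) (5 : Fin 6) •
          (axis : EuclideanSpace ℝ (Fin 6)))) :
    HasStrictFDerivAt Ψ
      (fderiv ℝ Ψ (extChartAt (𝓡 4) x₀ x₀, 0, 0)) (extChartAt (𝓡 4) x₀ x₀, 0, 0) :=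
  (contDiffAt_tubeChart hι hιN hνs hνt x₀ hΨ (p := (extChartAt (𝓡 4) x₀ x₀, (0 : ℝ), (0 : ℝ)))
    (mem_extChartAt_target x₀)).hasStrictFDerivAt (by simp)

/-- **The `b`-partial of the tube chart** at the centre is the differential of the chart
representative `ι ∘ φ⁻¹` (on `ρ = r = 0` the tube chart IS `ι ∘ φ⁻¹`). [folklore] -/
theorem fderiv_tubeChart_inl (hι : Manifold.IsSmoothEmbedding (𝓡 4) (𝓡 6) ∞ ι)
    (hιN : ∀ x, ∑ i : Fin 5, ι x (Fin.castSucc i) ^ 2 = 1) (hνs : ContMDiff (𝓡 4) (𝓡 6) ∞ ν)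
    (hνt : ∀ x, ∑ i : Fin 5, ν x (Fin.castSucc i) * ι x (Fin.castSucc i) = 0) (x₀ : M)
    (hΨ : Ψ = fun p : EuclideanSpace ℝ (Fin 4) × ℝ × ℝ =>
      (fun z : EuclideanSpace ℝ (Fin 6) => (‖truncL z‖⁻¹ : ℝ) • (z - z (5 : Fin 6) •
        (axis : EuclideanSpace ℝ (Fin 6))) + z (5 : Fin 6) • (axis : EuclideanSpace ℝ (Fin 6)))
        (ι ((extChartAt (𝓡 4) x₀).symm p.1) + p.2.1 • ν ((extChartAt (𝓡 4) x₀).symm p.1)) +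
      p.2.2 • ((fun z : EuclideanSpace ℝ (Fin 6) => (‖truncL z‖⁻¹ : ℝ) • (z - z (5 : Fin 6) •
        (axis : EuclideanSpace ℝ (Fin 6))) + z (5 : Fin 6) • (axis : EuclideanSpace ℝ (Fin 6)))
        (ι ((extChartAt (𝓡 4) x₀).symm p.1) + p.2.1 • ν ((extChartAt (𝓡 4) x₀).symm p.1)) -
        ((fun z : EuclideanSpace ℝ (Fin 6) => (‖truncL z‖⁻¹ : ℝ) • (z - z (5 : Fin 6) •
        (axis : EuclideanSpace ℝ (Fin 6))) + z (5 : Fin 6) • (axis : EuclideanSpace ℝ (Fin 6)))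
        (ι ((extChartAt (𝓡 4) x₀).symm p.1) + p.2.1 • ν ((extChartAt (𝓡 4) x₀).symm p.1))) (5 : Fin 6) •
          (axis : EuclideanSpace ℝ (Fin 6))))
    (β : EuclideanSpace ℝ (Fin 4)) :
    fderiv ℝ Ψ (extChartAt (𝓡 4) x₀ x₀, 0, 0) (β, 0, 0) =
      (((mfderiv (𝓡 4) (𝓡 6) ι ((extChartAt (𝓡 4) x₀).symm (extChartAt (𝓡 4) x₀ x₀))).comp
        (mfderivWithin 𝓘(ℝ, EuclideanSpace ℝ (Fin 4)) (𝓡 4) (extChartAt (𝓡 4) x₀).symm (range (𝓡 4))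
          (extChartAt (𝓡 4) x₀ x₀))) : EuclideanSpace ℝ (Fin 4) →L[ℝ] EuclideanSpace ℝ (Fin 6)) β := by
  have hL := (hasStrictFDerivAt_tubeChart hι hιN hνs hνt x₀ hΨ).hasFDerivAt
  have h1 : HasFDerivAt (fun b : EuclideanSpace ℝ (Fin 4) => Ψ (b, ((0 : ℝ), (0 : ℝ))))
      ((fderiv ℝ Ψ (extChartAt (𝓡 4) x₀ x₀, 0, 0)).comp
        (ContinuousLinearMap.inl ℝ (EuclideanSpace ℝ (Fin 4)) (ℝ × ℝ))) (extChartAt (𝓡 4) x₀ x₀) :=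
    HasFDerivAt.comp (f := fun b : EuclideanSpace ℝ (Fin 4) => (b, ((0 : ℝ), (0 : ℝ))))
      (extChartAt (𝓡 4) x₀ x₀) hL (hasFDerivAt_prodMk_left (extChartAt (𝓡 4) x₀ x₀) ((0 : ℝ), (0 : ℝ)))
  have h2 : (ι ∘ (extChartAt (𝓡 4) x₀).symm) =ᶠ[𝓝 (extChartAt (𝓡 4) x₀ x₀)]
      fun b : EuclideanSpace ℝ (Fin 4) => Ψ (b, ((0 : ℝ), (0 : ℝ))) := by
    refine Filter.mem_of_superset ((isOpen_extChartAt_target x₀).mem_nhds (mem_extChartAt_target x₀))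
      fun b hb => ?_
    show (ι ∘ (extChartAt (𝓡 4) x₀).symm) b = Ψ (b, ((0 : ℝ), (0 : ℝ)))
    rw [tubeChart_zero_left hιN x₀ hΨ, zero_smul, add_zero]
    rfl
  have h3 : HasFDerivAt (ι ∘ (extChartAt (𝓡 4) x₀).symm) _ (extChartAt (𝓡 4) x₀ x₀) :=
    hasFDerivAt_chartRep hι x₀ (mem_extChartAt_target x₀)
  have heq := (h1.congr_of_eventuallyEq h2).unique h3
  have := congrArg (fun L : EuclideanSpace ℝ (Fin 4) →L[ℝ] EuclideanSpace ℝ (Fin 6) => L β) heq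
  rw [ContinuousLinearMap.comp_apply, ContinuousLinearMap.inl_apply] at this
  exact this

/-- **The `r`-partial of the tube chart** at the centre is the normal `ν x₀` (the push-off curve
`r ↦ nrm(ι x₀ + r ν x₀)` is tangent to `ν x₀`). [folklore] -/
theorem fderiv_tubeChart_r (hι : Manifold.IsSmoothEmbedding (𝓡 4) (𝓡 6) ∞ ι)
    (hιN : ∀ x, ∑ i : Fin 5, ι x (Fin.castSucc i) ^ 2 = 1) (hνs : ContMDiff (𝓡 4) (𝓡 6) ∞ ν)
    (hνt : ∀ x, ∑ i : Fin 5, ν x (Fin.castSucc i) * ι x (Fin.castSucc i) = 0) (x₀ : M)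
    (hΨ : Ψ = fun p : EuclideanSpace ℝ (Fin 4) × ℝ × ℝ =>
      (fun z : EuclideanSpace ℝ (Fin 6) => (‖truncL z‖⁻¹ : ℝ) • (z - z (5 : Fin 6) •
        (axis : EuclideanSpace ℝ (Fin 6))) + z (5 : Fin 6) • (axis : EuclideanSpace ℝ (Fin 6)))
        (ι ((extChartAt (𝓡 4) x₀).symm p.1) + p.2.1 • ν ((extChartAt (𝓡 4) x₀).symm p.1)) +
      p.2.2 • ((fun z : EuclideanSpace ℝ (Fin 6) => (‖truncL z‖⁻¹ : ℝ) • (z - z (5 : Fin 6) •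
        (axis : EuclideanSpace ℝ (Fin 6))) + z (5 : Fin 6) • (axis : EuclideanSpace ℝ (Fin 6)))
        (ι ((extChartAt (𝓡 4) x₀).symm p.1) + p.2.1 • ν ((extChartAt (𝓡 4) x₀).symm p.1)) -
        ((fun z : EuclideanSpace ℝ (Fin 6) => (‖truncL z‖⁻¹ : ℝ) • (z - z (5 : Fin 6) •
        (axis : EuclideanSpace ℝ (Fin 6))) + z (5 : Fin 6) • (axis : EuclideanSpace ℝ (Fin 6)))
        (ι ((extChartAt (𝓡 4) x₀).symm p.1) + p.2.1 • ν ((extChartAt (𝓡 4) x₀).symm p.1))) (5 : Fin 6) •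
          (axis : EuclideanSpace ℝ (Fin 6)))) :
    fderiv ℝ Ψ (extChartAt (𝓡 4) x₀ x₀, 0, 0) (0, 1, 0) = ν x₀ := by
  have hL := (hasStrictFDerivAt_tubeChart hι hιN hνs hνt x₀ hΨ).hasFDerivAt
  have hc : HasDerivAt (fun r : ℝ => (extChartAt (𝓡 4) x₀ x₀, r, (0 : ℝ)))
      ((0 : EuclideanSpace ℝ (Fin 4)), (1 : ℝ), (0 : ℝ)) 0 :=
    (hasDerivAt_const (0 : ℝ) (extChartAt (𝓡 4) x₀ x₀)).prodMk
      ((hasDerivAt_id (0 : ℝ)).prodMk (hasDerivAt_const (0 : ℝ) (0 : ℝ)))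
  have h1 : HasDerivAt (fun r : ℝ => Ψ (extChartAt (𝓡 4) x₀ x₀, r, (0 : ℝ)))
      (fderiv ℝ Ψ (extChartAt (𝓡 4) x₀ x₀, 0, 0) (0, 1, 0)) 0 :=
    HasFDerivAt.comp_hasDerivAt (l := Ψ)
      (f := fun r : ℝ => (extChartAt (𝓡 4) x₀ x₀, r, (0 : ℝ))) (0 : ℝ) hL hc
  have h2 : HasDerivAt (fun r : ℝ => Ψ (extChartAt (𝓡 4) x₀ x₀, r, (0 : ℝ))) (ν x₀) 0 := by
    have heq : (fun r : ℝ => Ψ (extChartAt (𝓡 4) x₀ x₀, r, (0 : ℝ))) = fun r : ℝ =>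
        (fun z : EuclideanSpace ℝ (Fin 6) => (‖truncL z‖⁻¹ : ℝ) • (z - z (5 : Fin 6) •
          (axis : EuclideanSpace ℝ (Fin 6))) + z (5 : Fin 6) • (axis : EuclideanSpace ℝ (Fin 6))) (ι x₀ + r • ν x₀) := by
      funext r
      rw [tubeChart_zero ι ν x₀ hΨ, extChartAt_to_inv]
    rw [heq]
    exact hasDerivAt_nrm_pushoff (hιN x₀) (hνt x₀)
  exact h1.unique h2

/-- **The `ρ`-partial of the tube chart** at the centre is the radial unit normal
`n(x₀) = ι x₀ - (ι x₀)₅ e₅` of `N`. [folklore] -/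
theorem fderiv_tubeChart_rho (hι : Manifold.IsSmoothEmbedding (𝓡 4) (𝓡 6) ∞ ι)
    (hιN : ∀ x, ∑ i : Fin 5, ι x (Fin.castSucc i) ^ 2 = 1) (hνs : ContMDiff (𝓡 4) (𝓡 6) ∞ ν)
    (hνt : ∀ x, ∑ i : Fin 5, ν x (Fin.castSucc i) * ι x (Fin.castSucc i) = 0) (x₀ : M)
    (hΨ : Ψ = fun p : EuclideanSpace ℝ (Fin 4) × ℝ × ℝ =>
      (fun z : EuclideanSpace ℝ (Fin 6) => (‖truncL z‖⁻¹ : ℝ) • (z - z (5 : Fin 6) •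
        (axis : EuclideanSpace ℝ (Fin 6))) + z (5 : Fin 6) • (axis : EuclideanSpace ℝ (Fin 6)))
        (ι ((extChartAt (𝓡 4) x₀).symm p.1) + p.2.1 • ν ((extChartAt (𝓡 4) x₀).symm p.1)) +
      p.2.2 • ((fun z : EuclideanSpace ℝ (Fin 6) => (‖truncL z‖⁻¹ : ℝ) • (z - z (5 : Fin 6) •
        (axis : EuclideanSpace ℝ (Fin 6))) + z (5 : Fin 6) • (axis : EuclideanSpace ℝ (Fin 6)))
        (ι ((extChartAt (𝓡 4) x₀).symm p.1) + p.2.1 • ν ((extChartAt (𝓡 4) x₀).symm p.1)) -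
        ((fun z : EuclideanSpace ℝ (Fin 6) => (‖truncL z‖⁻¹ : ℝ) • (z - z (5 : Fin 6) •
        (axis : EuclideanSpace ℝ (Fin 6))) + z (5 : Fin 6) • (axis : EuclideanSpace ℝ (Fin 6)))
        (ι ((extChartAt (𝓡 4) x₀).symm p.1) + p.2.1 • ν ((extChartAt (𝓡 4) x₀).symm p.1))) (5 : Fin 6) •
          (axis : EuclideanSpace ℝ (Fin 6)))) :
    fderiv ℝ Ψ (extChartAt (𝓡 4) x₀ x₀, 0, 0) (0, 0, 1) =
      ι x₀ - ι x₀ (5 : Fin 6) • (axis : EuclideanSpace ℝ (Fin 6)) := by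
  have hL := (hasStrictFDerivAt_tubeChart hι hιN hνs hνt x₀ hΨ).hasFDerivAt
  have hc : HasDerivAt (fun ρ : ℝ => (extChartAt (𝓡 4) x₀ x₀, (0 : ℝ), ρ))
      ((0 : EuclideanSpace ℝ (Fin 4)), (0 : ℝ), (1 : ℝ)) 0 :=
    (hasDerivAt_const (0 : ℝ) (extChartAt (𝓡 4) x₀ x₀)).prodMk
      ((hasDerivAt_const (0 : ℝ) (0 : ℝ)).prodMk (hasDerivAt_id (0 : ℝ)))
  have h1 : HasDerivAt (fun ρ : ℝ => Ψ (extChartAt (𝓡 4) x₀ x₀, (0 : ℝ), ρ))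
      (fderiv ℝ Ψ (extChartAt (𝓡 4) x₀ x₀, 0, 0) (0, 0, 1)) 0 :=
    HasFDerivAt.comp_hasDerivAt (l := Ψ)
      (f := fun ρ : ℝ => (extChartAt (𝓡 4) x₀ x₀, (0 : ℝ), ρ)) (0 : ℝ) hL hc
  have h2 : HasDerivAt (fun ρ : ℝ => Ψ (extChartAt (𝓡 4) x₀ x₀, (0 : ℝ), ρ))
      (ι x₀ - ι x₀ (5 : Fin 6) • (axis : EuclideanSpace ℝ (Fin 6))) 0 := by
    have heq : (fun ρ : ℝ => Ψ (extChartAt (𝓡 4) x₀ x₀, (0 : ℝ), ρ)) = fun ρ : ℝ =>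
        ι x₀ + ρ • (ι x₀ - ι x₀ (5 : Fin 6) • (axis : EuclideanSpace ℝ (Fin 6))) := by
      funext ρ
      rw [tubeChart_zero_left hιN x₀ hΨ, extChartAt_to_inv]
    rw [heq]
    have := ((hasDerivAt_id (0 : ℝ)).smul_const (ι x₀ - ι x₀ (5 : Fin 6) •
      (axis : EuclideanSpace ℝ (Fin 6)))).const_add (ι x₀)
    simpa using this
  exact h1.unique h2

end TubeChart

/-- Marker of this part (registered sub-goal `helper_sepPersistsRadScale` of stmt-SmoothPoincare4-7632): scaling the horizontal part of a point of `N` by `1 + ρ`, `|ρ| < 1`, stays in `N` only for `ρ = 0` (`radScale_mem_iff`, the device forcing the scaling parameter of the tube chart to vanish on `N`). [folklore] -/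
theorem helper_sepPersistsRadScale :
    ∀ (w : EuclideanSpace ℝ (Fin 6)), (∑ i : Fin 5, w (Fin.castSucc i) ^ 2 = 1) → ∀ ρ : ℝ, |ρ| < 1 → ((∑ i : Fin 5, (w + ρ • (w - w 5 • Literature.Geometry.Manifold.CylinderSlice.axis)) (Fin.castSucc i) ^ 2 = 1) ↔ ρ = 0) :=
  fun _ hw _ hρ => radScale_mem_iff hw hρ

end Summit.SmoothPoincare4.SmoothPoincare4.Theorems.CylinderEntropySliceIsolation
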